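import Summits.RiemannHypothesis.RiemannHypothesis.Theorems.SuzukiThetaFlowDefs
import Summits.RiemannHypothesis.RiemannHypothesis.Theorems.SuzukiWindowFactorisation
import Literature.NumberTheory.LFunctions.WeilExplicitProofs

/-!
# Causality of the window outputs and the pairing lemma for `FlowPairing` (column DBR; RH-FREE)

RH-FREE throughout; nothing here bears on the truth of RH.  Operator-side infrastructure for the
pairing algebra of `Theorems.SuzukiThetaFlowDefs.FlowPairing`
(`2⟨𝖪_θ[t]f, 𝒥_θ[t]f⟩ = −2·Re weilQuadratic(g_θ)`, `g_θ = winOut θ t f`):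

* `winOp_limKernel_eq_zero_of_le` — CAUSALITY: `(𝖪_θ[t] f)(x) = 0` for `x ≤ −t` (`K_θ = 0` on `(−∞,0]`);
* `weilConv_winOut_weilReflect_of_nonneg` — THE PAIRING LEMMA: for `v ≥ 0` the autocorrelation
  `φ = g_θ ⋆ g̃_θ` of the window output is the window pairing of the output with its shift,
  `φ(v) = ∫_{(−t,t)} (𝖪_θ[t]f)(x)·(𝖪_θ[t]f)(x − v) dx` — the identity that turns each causal piece
  `k(v) K_θ(w − v)` of the flow kernel `J_θ = k ∗ K_θ` (`invFourierLine_flowSymbol_mul_limTheta_explicit`)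
  into `k(v) φ(v)` after the window integrations;
* `weilConv_winOut_weilReflect_even` — `φ` is real and even (with the tree's `conj_weilConv_weilReflect_neg`); `weilConv_winOut_weilReflect_eq_zero`
  — `φ(v) = 0` for `|v| ≥ 2t`, whence `HasCompactSupport φ`.

References: [Su20] M. Suzuki, ASPM 84 (2020) = arXiv:1907.07302, (1.4), (1.9); E. Bombieri, Rend. Lincei (9)
11 (2000), §2.
-/

noncomputable section

-- D-0017: `Summit.<S>.<S>.…` is the designed namespace of a single-problem summit.
set_option linter.dupNamespace false

open Complex MeasureTheory Set
open scoped ComplexConjugate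

namespace Summit.RiemannHypothesis.RiemannHypothesis.Theorems.SuzukiThetaFlow

open Literature.NumberTheory.LFunctions
open Summit.RiemannHypothesis.RiemannHypothesis.Theorems.SuzukiKernelSemigroup

/-! ## §1 Causality -/

/-- **RH-FREE · CAUSALITY of the window output**: for `θ > 1` and `x ≤ −t`, `(𝖪_θ[t] f)(x) = 0`
(for `y ∈ (−t,t)`, `x + y < 0` and `K_θ` vanishes on `(−∞,0]`). -/
theorem winOp_limKernel_eq_zero_of_le {θ : ℝ} (hθ : 1 < θ) {t x : ℝ} (hx : x ≤ -t) (f : ℝ → ℝ) :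
    winOp (limKernel θ) t f x = 0 := by
  unfold winOp
  refine setIntegral_eq_zero_of_forall_eq_zero fun y hy ↦ ?_
  rw [limKernel_eq_zero_of_nonpos hθ (by linarith [hy.2]), zero_mul]

/-- RH-FREE.  The shifted output is a window integral against the shifted kernel:
`(𝖪[t]f)(x − v) = ∫_{(−t,t)} K(x + y − v) f(y) dy`. -/
theorem winOp_sub_eq (K : ℝ → ℝ) (t : ℝ) (f : ℝ → ℝ) (x v : ℝ) :
    winOp K t f (x - v) = ∫ y in Ioo (-t) t, K (x + y - v) * f y := by
  unfold winOp
  refine setIntegral_congr_fun measurableSet_Ioo fun y _ ↦ ?_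
  ring_nf

/-- RH-FREE.  Values of the window output `g_θ = winOut θ t f`: the real window function, cut off to
`(−t,t)` and read in `ℂ`. -/
theorem winOut_apply (θ t : ℝ) (f : ℝ → ℝ) (x : ℝ) :
    winOut θ t f x = (((Ioo (-t) t).indicator (winOp (limKernel θ) t f) x : ℝ) : ℂ) := rfl

/-- RH-FREE.  `g_θ` is real: `conj g_θ(x) = g_θ(x)`. -/
theorem conj_winOut (θ t : ℝ) (f : ℝ → ℝ) (x : ℝ) : conj (winOut θ t f x) = winOut θ t f x := by
  rw [winOut_apply, Complex.conj_ofReal]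

/-- RH-FREE.  `g_θ` vanishes off `(−t,t)`. -/
theorem winOut_eq_zero_of_not_mem {θ t : ℝ} {f : ℝ → ℝ} {x : ℝ} (hx : x ∉ Ioo (-t) t) : winOut θ t f x = 0 := by
  rw [winOut_apply, Set.indicator_of_notMem hx, Complex.ofReal_zero]

/-- RH-FREE.  On the window `g_θ = 𝖪_θ[t] f`. -/
theorem winOut_eq_of_mem {θ t : ℝ} {f : ℝ → ℝ} {x : ℝ} (hx : x ∈ Ioo (-t) t) :
    winOut θ t f x = (winOp (limKernel θ) t f x : ℂ) := by
  rw [winOut_apply, Set.indicator_of_mem hx]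

/-- RH-FREE.  **Causal extension**: for `θ > 1`, every `x < t` (inside OR to the left of the window) has
`g_θ(x) = (𝖪_θ[t] f)(x)` — to the left both vanish by causality. -/
theorem winOut_eq_of_lt {θ : ℝ} (hθ : 1 < θ) {t : ℝ} (f : ℝ → ℝ) {x : ℝ} (hx : x < t) :
    winOut θ t f x = (winOp (limKernel θ) t f x : ℂ) := by
  by_cases hx' : -t < x
  · exact winOut_eq_of_mem ⟨hx', hx⟩
  · rw [winOut_eq_zero_of_not_mem (fun h ↦ hx' h.1), winOp_limKernel_eq_zero_of_le hθ (not_lt.1 hx') f,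
      Complex.ofReal_zero]

/-! ## §2 The pairing lemma -/

/-- RH-FREE.  The autocorrelation integrand of `g_θ`, unfolded: `g_θ(u)·g̃_θ(v − u) = g_θ(u)·g_θ(u − v)`. -/
theorem winOut_mul_weilReflect (θ t : ℝ) (f : ℝ → ℝ) (u v : ℝ) :
    winOut θ t f u * weilReflect (winOut θ t f) (v - u) = winOut θ t f u * winOut θ t f (u - v) := by
  rw [weilReflect, neg_sub, conj_winOut]

/-- **RH-FREE · THE PAIRING LEMMA**: for `θ > 1` and `v ≥ 0`,
`(g_θ ⋆ g̃_θ)(v) = ∫_{(−t,t)} (𝖪_θ[t]f)(x)·(𝖪_θ[t]f)(x − v) dx` (for `x < t` and `v ≥ 0` the shifted point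
`x − v` is `< t`, where `g_θ` IS the causal output).  Nothing here bears on RH. -/
theorem weilConv_winOut_weilReflect_of_nonneg {θ : ℝ} (hθ : 1 < θ) (t : ℝ) (f : ℝ → ℝ) {v : ℝ}
    (hv : 0 ≤ v) :
    weilConv (winOut θ t f) (weilReflect (winOut θ t f)) v =
      (((∫ x in Ioo (-t) t, winOp (limKernel θ) t f x * winOp (limKernel θ) t f (x - v) : ℝ)) : ℂ) := by
  rw [weilConv_apply]
  simp_rw [winOut_mul_weilReflect]
  -- the integrand is the indicator (of the window) of `x ↦ 𝖪f(x)·𝖪f(x − v)`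
  have hpt : (fun u : ℝ ↦ winOut θ t f u * winOut θ t f (u - v)) =
      (Ioo (-t) t).indicator fun u : ℝ ↦
        (((winOp (limKernel θ) t f u * winOp (limKernel θ) t f (u - v) : ℝ)) : ℂ) := by
    funext u
    by_cases hu : u ∈ Ioo (-t) t
    · rw [Set.indicator_of_mem hu, winOut_eq_of_mem hu,
        winOut_eq_of_lt hθ f (by linarith [hu.2] : u - v < t), Complex.ofReal_mul]
    · rw [Set.indicator_of_notMem hu, winOut_eq_zero_of_not_mem hu, zero_mul]
  rw [hpt, MeasureTheory.integral_indicator measurableSet_Ioo, integral_complex_ofReal]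

/-- RH-FREE.  The same, with the shifted output unfolded: for `v ≥ 0`,
`(g_θ ⋆ g̃_θ)(v) = ∫_{(−t,t)} (𝖪_θ[t]f)(x) (∫_{(−t,t)} K_θ(x + y − v) f(y) dy) dx`. -/
theorem weilConv_winOut_weilReflect_eq_window {θ : ℝ} (hθ : 1 < θ) (t : ℝ) (f : ℝ → ℝ) {v : ℝ}
    (hv : 0 ≤ v) :
    weilConv (winOut θ t f) (weilReflect (winOut θ t f)) v =
      (((∫ x in Ioo (-t) t, winOp (limKernel θ) t f x *
        ∫ y in Ioo (-t) t, limKernel θ (x + y - v) * f y : ℝ)) : ℂ) := by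
  rw [weilConv_winOut_weilReflect_of_nonneg hθ t f hv]
  congr 1
  refine setIntegral_congr_fun measurableSet_Ioo fun x _ ↦ ?_
  rw [winOp_sub_eq]

/-! ## §3 Reality, evenness, support -/

/-- RH-FREE.  For `v ≥ 0` the autocorrelation of the window output is real. -/
theorem weilConv_winOut_weilReflect_im_of_nonneg {θ : ℝ} (hθ : 1 < θ) (t : ℝ) (f : ℝ → ℝ) {v : ℝ}
    (hv : 0 ≤ v) : (weilConv (winOut θ t f) (weilReflect (winOut θ t f)) v).im = 0 := by
  rw [weilConv_winOut_weilReflect_of_nonneg hθ t f hv, Complex.ofReal_im]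

/-- **RH-FREE · the autocorrelation of the window output is REAL and EVEN**: for `θ > 1` and all real `v`,
`(g_θ ⋆ g̃_θ)(−v) = (g_θ ⋆ g̃_θ)(v)` and `Im (g_θ ⋆ g̃_θ)(v) = 0`. -/
theorem weilConv_winOut_weilReflect_even {θ : ℝ} (hθ : 1 < θ) (t : ℝ) (f : ℝ → ℝ) (v : ℝ) :
    weilConv (winOut θ t f) (weilReflect (winOut θ t f)) (-v) =
      weilConv (winOut θ t f) (weilReflect (winOut θ t f)) v ∧
    (weilConv (winOut θ t f) (weilReflect (winOut θ t f)) v).im = 0 := by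
  rcases le_or_gt 0 v with hv | hv
  · have him := weilConv_winOut_weilReflect_im_of_nonneg hθ t f hv
    have h := conj_weilConv_weilReflect_neg (winOut θ t f) v
    refine ⟨?_, him⟩
    rw [← Complex.conj_conj (weilConv (winOut θ t f) (weilReflect (winOut θ t f)) (-v)), h,
      Complex.conj_eq_iff_im.2 him]
  · have him := weilConv_winOut_weilReflect_im_of_nonneg hθ t f (by linarith : 0 ≤ -v)
    have h := conj_weilConv_weilReflect_neg (winOut θ t f) (-v)
    rw [neg_neg] at h
    -- `h : conj φ(v) = φ(−v)`
    have him' : (weilConv (winOut θ t f) (weilReflect (winOut θ t f)) v).im = 0 := by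
      have := congrArg Complex.im h
      rw [Complex.conj_im, him] at this
      linarith
    refine ⟨?_, him'⟩
    rw [← h, Complex.conj_eq_iff_im.2 him']

/-- RH-FREE.  The autocorrelation as a real number for every `v`:
`(g_θ ⋆ g̃_θ)(v) = ∫_{(−t,t)} (𝖪_θ[t]f)(x)(𝖪_θ[t]f)(x − |v|) dx`. -/
theorem weilConv_winOut_weilReflect_eq_abs {θ : ℝ} (hθ : 1 < θ) (t : ℝ) (f : ℝ → ℝ) (v : ℝ) :
    weilConv (winOut θ t f) (weilReflect (winOut θ t f)) v =
      (((∫ x in Ioo (-t) t, winOp (limKernel θ) t f x * winOp (limKernel θ) t f (x - |v|) : ℝ)) : ℂ) := by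
  rcases le_or_gt 0 v with hv | hv
  · rw [abs_of_nonneg hv, weilConv_winOut_weilReflect_of_nonneg hθ t f hv]
  · rw [abs_of_neg hv, ← weilConv_winOut_weilReflect_of_nonneg hθ t f (by linarith : 0 ≤ -v),
      (weilConv_winOut_weilReflect_even hθ t f v).1]

/-- RH-FREE.  **Support**: `(g_θ ⋆ g̃_θ)(v) = 0` for `|v| ≥ 2t` (the window and its shift are disjoint). -/
theorem weilConv_winOut_weilReflect_eq_zero {θ : ℝ} (hθ : 1 < θ) (t : ℝ) (f : ℝ → ℝ) {v : ℝ}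
    (hv : 2 * t ≤ |v|) : weilConv (winOut θ t f) (weilReflect (winOut θ t f)) v = 0 := by
  rw [weilConv_winOut_weilReflect_eq_abs hθ t f v]
  have h0 : ∫ x in Ioo (-t) t, winOp (limKernel θ) t f x * winOp (limKernel θ) t f (x - |v|) = 0 := by
    refine setIntegral_eq_zero_of_forall_eq_zero fun x hx ↦ ?_
    rw [winOp_limKernel_eq_zero_of_le hθ (x := x - |v|) (by linarith [hx.2]) f, mul_zero]
  rw [h0, Complex.ofReal_zero]

/-- RH-FREE.  Hence the autocorrelation of the window output has compact support (inside `[−2|t|−1, 2|t|+1]`). -/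
theorem hasCompactSupport_weilConv_winOut_weilReflect {θ : ℝ} (hθ : 1 < θ) (t : ℝ) (f : ℝ → ℝ) :
    HasCompactSupport (weilConv (winOut θ t f) (weilReflect (winOut θ t f))) := by
  refine HasCompactSupport.of_support_subset_isCompact (isCompact_Icc (a := -(2 * |t| + 1)) (b := 2 * |t| + 1))
    fun v hv ↦ ?_
  rw [Function.mem_support] at hv
  by_contra hv'
  rw [mem_Icc, not_and_or, not_le, not_le] at hv'
  apply hv
  refine weilConv_winOut_weilReflect_eq_zero hθ t f ?_
  have ht : t ≤ |t| := le_abs_self t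
  rcases hv' with h | h
  · rw [abs_of_neg (by linarith [abs_nonneg t])]; linarith
  · rw [abs_of_pos (by linarith [abs_nonneg t])]; linarith

/-- RH-FREE.  The value at `0`: `(g_θ ⋆ g̃_θ)(0) = ‖𝖪_θ[t] f‖²_{L²(−t,t)}` (`= winNormSq`). -/
theorem weilConv_winOut_weilReflect_zero {θ : ℝ} (hθ : 1 < θ) (t : ℝ) (f : ℝ → ℝ) :
    weilConv (winOut θ t f) (weilReflect (winOut θ t f)) 0 = ((winNormSq (limKernel θ) t f : ℝ) : ℂ) := by
  rw [weilConv_winOut_weilReflect_of_nonneg hθ t f le_rfl]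
  congr 1
  unfold winNormSq
  refine setIntegral_congr_fun measurableSet_Ioo fun x _ ↦ ?_
  rw [sub_zero, sq]

end Summit.RiemannHypothesis.RiemannHypothesis.Theorems.SuzukiThetaFlow

end
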